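import Literature.Geometry.Lorentzian.LorentzianMetric
import HarnessLib

/-!
# Spacelike slopes along a causal direction form an interval containing `0`

Helper algebra for the support-controlled smoothing of rough Cauchy hypersurfaces (door `S_c↑` of route
`RootDecompTrappedGauge`, decomp-fsc lens-4 g27 addendum, porting item P4 of the L2 blueprint): if `w` and `w + T` are
spacelike and `T` is causal-or-zero (`g(T,T) ≤ 0`), then `w + λ T` is spacelike for every `λ ∈ [0,1]` — the quadratic
`λ ↦ g(w + λT, w + λT)` is concave. Scalar form `quadratic_pos_of_concave_of_pos_endpoints`. Everything is proved; no
definitions, no named facts.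
-/

open Set Function
open scoped Manifold ContDiff Topology

-- D-0017: the namespace mirrors the Theorems path of this file (`linter.dupNamespace` is off for the whole `Summits`
-- library in `lakefile.toml`, so no in-file override is needed).
namespace Summit.FinalStateConjecture.FinalStateConjecture.Theorems

open Literature.Geometry.Lorentzian

namespace SpacelikeSlopeInterval

/-! ### P4: concavity of the norm-square along a causal direction -/

/-- A concave quadratic positive at `0` and at `1` is positive on `[0, 1]`. [folklore] -/
theorem quadratic_pos_of_concave_of_pos_endpoints {a b c t : ℝ} (hc : c ≤ 0) (h0 : 0 < a)
    (h1 : 0 < a + 2 * b + c) (ht0 : 0 ≤ t) (ht1 : t ≤ 1) : 0 < a + 2 * b * t + c * t ^ 2 := by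
  have key : (1 - t) * a + t * (a + 2 * b + c) ≤ a + 2 * b * t + c * t ^ 2 := by
    nlinarith [mul_nonneg ht0 (sub_nonneg.mpr ht1)]
  rcases eq_or_lt_of_le ht0 with rfl | ht0'
  · simpa using h0
  · have : 0 < (1 - t) * a + t * (a + 2 * b + c) := by
      have h1' : 0 < t * (a + 2 * b + c) := mul_pos ht0' h1
      nlinarith [mul_nonneg (sub_nonneg.mpr ht1) h0.le]
    exact lt_of_lt_of_le this key


variable {E : Type*} [NormedAddCommGroup E] [NormedSpace ℝ E] {H : Type*} [TopologicalSpace H]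
  {I : ModelWithCorners ℝ E H} {M : Type*} [TopologicalSpace M] [ChartedSpace H M]
  [IsManifold I ∞ M] {n : ℕ∞ω} {g : LorentzianMetric I n M}

/-- **The spacelike slopes along a causal direction form an interval containing `0`** (the algebra of the smooth-max step of the L2
blueprint): if `g(T, T) ≤ 0` and both `w` and `w + T` have positive norm-square, then so does `w + t • T` for every `t ∈ [0, 1]`.
[folklore] -/
theorem val_pos_add_smul_of_val_pos {x : M} (w T : TangentSpace I x) (hT : g.val x T T ≤ 0)
    (h0 : 0 < g.val x w w) (h1 : 0 < g.val x (w + T) (w + T)) {t : ℝ} (ht0 : 0 ≤ t) (ht1 : t ≤ 1) :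
    0 < g.val x (w + t • T) (w + t • T) := by
  have hsymm : g.val x T w = g.val x w T := g.symm x T w
  have e1 : g.val x (w + T) (w + T) = g.val x w w + 2 * g.val x w T + g.val x T T := by
    simp only [map_add, add_apply, hsymm]; ring
  have e2 : g.val x (w + t • T) (w + t • T) =
      g.val x w w + 2 * g.val x w T * t + g.val x T T * t ^ 2 := by
    simp only [map_add, map_smul, add_apply, smul_apply,
      smul_eq_mul, hsymm]; ring
  rw [e2]
  exact quadratic_pos_of_concave_of_pos_endpoints hT h0 (e1 ▸ h1) ht0 ht1

end SpacelikeSlopeInterval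

end Summit.FinalStateConjecture.FinalStateConjecture.Theorems
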